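import Summits.Parity.GeneralizedHardyLittlewood.Theorems.PrimeLevelFamEdgeMomentsBeyondDiagonalDiagDecorMasterInputs
import Summits.Parity.GeneralizedHardyLittlewood.Theorems.PrimeLevelFamEdgeMomentsBeyondDiagonalDiagDecorLogShiftTau11
import Mathlib.Algebra.Group.ForwardDiff
import HarnessLib

/-!
# Route `PrimeLevelFamEdge`, crux K_A `MomentsBeyondDiagonal` (stmt-Parity-20007), line «petersson_layers» v4, stub `stub_diag`:
# **master inputs for the two monomial families of the order-`(1,1)` weight: `(log k)^σ·τ(k)` (`σ = 1 ↦ (−2P′,1)`,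
# `σ = 2 ↦ (2P,0)`, `σ ≥ 3`: no main term, crude size `log^{σ−3}M`) and `(log k)^σ·P₂(k)τ(k)` (`σ = 0 ↦ (−2P,0)`, `σ ≥ 1`: crude
# size `log^{σ−1}M`)**

Census R3(ii), ANALYTIC HALF. By the closed form of `…DiagDecorWeightOneOne` (p824224) the polynomial part of the order-`(1,1)`
target of `…DiagOrderSelberg` is `Sel(τ(k₁)τ(k₂)·[L³/24 + (E₀₀/4)L² + (E₀₁−2μ₂)L + E₁₁ − (P₂(k₁)+P₂(k₂))(L/8 + E₀₀/4)])`,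
`L = 2 log Q − 2 log g − log k₁ − log k₂`; after the multinomial expansion of `L^m` every `log g`-free monomial is a product
`(log k₁)^{σ₁}t₁(k₁)·(log k₂)^{σ₂}t₂(k₂)` with `t_i ∈ {τ, P₂τ}`, evaluated by the master step
`…DiagDecorBilinearTwoScale.abs_selbergMonomial_two_scale_sub_le` (main term) or `…DiagDecorCrudeMonomial` (no main term).
This file supplies ALL their one-variable inputs (`a_n(k) = copTauW n k = W(k)[(k,n)=1]τ(k)`, `E_n = mainConst n`,
`D = divWeight`, `u_n = log(M/n)/log M`; `σ = 0`, `t = τ` is `…DiagDecorMasterInputs.masterInput_tau ↦ (P″,2)`):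

* `kappaCoeff_eq_zero_of_three_le` — the engine coefficient `κ_{σ,c} = Σ_β C(σ,β)(−1)^β(c+β)(c+β−1)` of `…DiagDecorLogPow`
  (`−2c`, `2` for `σ = 1, 2`) VANISHES for `σ ≥ 3` (a forward difference of order `σ` of a quadratic;
  `Polynomial.fwdDiff_iter_eq_zero_of_degree_lt`);
* `masterInput_tau_log` — **`(log k)·τ(k) ↦ (R,s) = (−2P′, 1)`**; `masterInput_tau_logSq` — **`(log k)²τ(k) ↦ (2P, 0)`**
  (two-scale master format, second scale unused);
* `abs_decorProfile_tau_logPow_le` — **`σ ≥ 3`: `|𝒮| ≤ C·D(n)(1+κ(n))·log^{σ−2}M/log M`** (crude-size input of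
  `abs_selbergMonomial_crude_kappa_le`, `A(M) = log^{σ−2}M/log M`);
* `masterInput_tau_primeSq` — **`P₂(k)τ(k) ↦ (−2P, 0)`** (`…DiagDecorPrimeSq`); `abs_copTauW_primeSq_logPow_sum_le`,
  `abs_decorProfile_tau_primeSq_logPow_le` — **`σ ≥ 1`: `(log k)^σP₂(k)τ(k)` has no main term, `|𝒮| ≤ C·D(1+κ)·log^σM/log M`**.

With `R₀ = P″, R₁ = −2P′, R₂ = 2P` the `log g`-free part of `Sel(ττL^m)` is `(π²/6)²Φ_m·log^{m−3}M + O(log^{m−4}M)`,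
`Φ_m = Σ_{σ₁,σ₂≤2, σ₁+σ₂≤m} m!/((m−σ₁−σ₂)!σ₁!σ₂!)(2/Δ′)^{m−σ₁−σ₂}(−1)^{σ₁+σ₂}∫₀¹R_{σ₁}R_{σ₂}` (hand check: `m = 1` gives order
`(0,0)`, `m = 3` with the `P₂` family gives `τ₁₁ = B₁₁/2`). Def-free; theorems only. Helper `--supports stmt-Parity-20007`;
closes nothing; K_A, K_B and the Parity summit are NOT proved; nothing about Landau–Siegel zeros.

## References
* E. Kowalski, P. Michel, J. VanderKam, J. reine angew. Math. 526 (2000), (23)–(28) pp. 13–15 and Prop. 5.1 p. 18.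
  [cite: KowalskiMichelVanderKam2000, (23)–(28) — derivation (monomials of the diagonal main term in real variables)]
-/

noncomputable section

open scoped Real ArithmeticFunction.Moebius fwdDiff
open Finset ArithmeticFunction Polynomial

namespace Summit.Parity.GeneralizedHardyLittlewood.Theorems.MomentsBeyondDiagonal.DiagKernel

open Literature.NumberTheory.LFunctions Literature.NumberTheory.LFunctions.KMV2000
open MollifierMainTerm (W)
open SelbergCoord (kappa)
open Literature.NumberTheory.Sieve (one_le_log_of_three_le)
open Summit.Parity.GeneralizedHardyLittlewood.Theorems.BeyondDiagonalBeatsQuarter.KernelFormXSq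
  (copTauW copTauW_apply mainConst divWeight divWeight_nonneg mainConst_nonneg)

/-- `κ(n) ≥ 0`. [folklore] -/
private theorem kappa_nonneg' (n : ℕ) : 0 ≤ kappa n := by
  unfold kappa
  exact Finset.sum_nonneg fun p hp ↦ by
    have hp2 : (2 : ℝ) ≤ p := by exact_mod_cast (Nat.prime_of_mem_primeFactors hp).two_le
    exact div_nonneg (Real.log_nonneg (by linarith)) (by linarith)

/-- The bridge `W(k)[(k,n)=1]·τ(k) = a_n(k)`. [folklore] -/
private theorem copW_mul_card_eq (n k : ℕ) :
    (if k.Coprime n then W k else 0) * (k.divisors.card : ℝ) = copTauW n k := by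
  rw [copTauW_apply]
  split_ifs <;> ring
/-! ### The engine coefficients `κ_{σ,c}` -/

/-- `κ_{σ,c} = 0` for `σ ≥ 3`: the `σ`-th forward difference of the quadratic `r(r−1)` vanishes. [folklore] -/
theorem kappaCoeff_eq_zero_of_three_le {σ : ℕ} (hσ : 3 ≤ σ) (c : ℕ) :
    ∑ β ∈ Finset.range (σ + 1), (σ.choose β : ℝ) * (-1) ^ β *
        (((c + β : ℕ) : ℝ) * (((c + β : ℕ) : ℝ) - 1)) = 0 := by
  -- the quadratic `X(X − 1)` has degree `< σ`
  have hdeg : (X * (X - 1) : ℝ[X]).natDegree < σ := by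
    have h1 : (X * (X - 1) : ℝ[X]).natDegree ≤ 2 := by
      calc (X * (X - 1) : ℝ[X]).natDegree ≤ (X : ℝ[X]).natDegree + (X - 1 : ℝ[X]).natDegree :=
            Polynomial.natDegree_mul_le
        _ ≤ 1 + 1 := by
            gcongr
            · exact Polynomial.natDegree_X_le
            · exact (Polynomial.natDegree_sub_le _ _).trans (by simp)
    omega
  have h0 := congr_fun (Polynomial.fwdDiff_iter_eq_zero_of_degree_lt hdeg) (c : ℝ)
  rw [fwdDiff_iter_eq_sum_shift] at h0
  simp only [Pi.zero_apply, nsmul_eq_mul, mul_one, zsmul_eq_mul, Int.cast_mul, Int.cast_pow, Int.cast_neg,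
    Int.cast_one, Int.cast_natCast, eval_mul, eval_sub, eval_X, eval_one] at h0
  -- `(−1)^{σ−β} = (−1)^σ(−1)^β`
  have hsign : ∀ β ∈ Finset.range (σ + 1), ((-1 : ℝ) ^ (σ - β)) = (-1) ^ σ * (-1) ^ β := by
    intro β hβ
    have hβ' : β ≤ σ := Nat.lt_succ_iff.1 (Finset.mem_range.1 hβ)
    rw [← pow_add, show σ + β = (σ - β) + 2 * β by omega, pow_add, pow_mul]
    norm_num
  have h1 : ∑ β ∈ Finset.range (σ + 1), (-1 : ℝ) ^ (σ - β) * (σ.choose β : ℝ) * (((c : ℝ) + β) * ((c : ℝ) + β - 1)) =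
      (-1) ^ σ * ∑ β ∈ Finset.range (σ + 1), (σ.choose β : ℝ) * (-1) ^ β *
        (((c + β : ℕ) : ℝ) * (((c + β : ℕ) : ℝ) - 1)) := by
    rw [Finset.mul_sum]
    refine Finset.sum_congr rfl fun β hβ ↦ ?_
    rw [hsign β hβ]
    push_cast
    ring
  rw [h1] at h0
  have hne : ((-1 : ℝ) ^ σ) ≠ 0 := pow_ne_zero _ (by norm_num)
  exact (mul_eq_zero.1 h0).resolve_left hne
/-! ### `(log k)^σ·τ(k)`: `σ = 1, 2` in master format -/

/-- **Master input `t = (log k)·τ(k)`**: `R = −2P′`, `s = 1` (`P₀ = P₁ = 0`; two-scale format, second scale unused).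
[cite: KowalskiMichelVanderKam2000, (23)–(28) and Prop. 5.1 — derivation] -/
theorem masterInput_tau_log (P : ℝ[X]) (hP0 : P.coeff 0 = 0) (hP1 : P.coeff 1 = 0) :
    ∃ C : ℝ, 0 ≤ C ∧ ∀ M : ℝ, 3 ≤ M → ∀ n : ℕ, n ≠ 0 → (n : ℝ) ≤ M →
      |∑ c ∈ Finset.range (P.natDegree + 1), P.coeff c *
          ((∑ k ∈ Icc 1 ⌊M / n⌋₊, (if k.Coprime n then W k else 0) * ((k.divisors.card : ℝ) * Real.log k) *
            Real.log (M / n / k) ^ c) / Real.log M ^ c) -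
        mainConst n * (-(2 : ℝ) • derivative P).eval (Real.log (M / n) / Real.log M) / Real.log M ^ 1| ≤
        C * divWeight n * ((1 + kappa n) / Real.log M ^ (1 + 1) +
          1 / ((1 + Real.log (M / n)) ^ 2 * Real.log M ^ 1)) := by
  -- profile layer with `m_c = −2c`, `s = 1`
  obtain ⟨C, hC, h⟩ := abs_profileLayer_sub_le
    (fun n y c ↦ ∑ k ∈ Icc 1 ⌊y⌋₊, (if k.Coprime n then W k else 0) * ((k.divisors.card : ℝ) * Real.log k) *
      Real.log (y / k) ^ c)
    (fun c ↦ -(2 * (c : ℝ))) (le_refl 1) (fun c hc ↦ by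
      obtain ⟨K, hK, hK'⟩ := abs_coprimeSumPow_log_sub_le hc
      refine ⟨K, hK, fun n hn y hy ↦ ?_⟩
      have hκ := kappa_nonneg' n
      have hD := divWeight_nonneg n
      have hre : ∑ k ∈ Icc 1 ⌊y⌋₊, (if k.Coprime n then W k else 0) * ((k.divisors.card : ℝ) * Real.log k) *
          Real.log (y / k) ^ c = ∑ k ∈ Icc 1 ⌊y⌋₊, copTauW n k * Real.log k * Real.log (y / k) ^ c :=
        Finset.sum_congr rfl fun k _ ↦ by rw [← copW_mul_card_eq]; ring
      rw [hre, show ∑ k ∈ Icc 1 ⌊y⌋₊, copTauW n k * Real.log k * Real.log (y / k) ^ c -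
          -(2 * (c : ℝ)) * mainConst n * Real.log y ^ (c - 1) =
          ∑ k ∈ Icc 1 ⌊y⌋₊, copTauW n k * Real.log k * Real.log (y / k) ^ c +
            2 * (c : ℝ) * mainConst n * Real.log y ^ (c - 1) by ring]
      have hly : 0 ≤ Real.log y := Real.log_nonneg hy
      calc _ ≤ K * divWeight n * (1 + Real.log y) ^ (c - 2) := hK' n hn y hy
        _ = K * divWeight n * 1 * (1 + Real.log y) ^ (c - 1 - 1) := by
            rw [mul_one, show c - 1 - 1 = c - 2 by omega]
        _ ≤ K * divWeight n * (1 + kappa n) * (1 + Real.log y) ^ (c - 1 - 1) :=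
            mul_le_mul_of_nonneg_right (mul_le_mul_of_nonneg_left (by linarith) (by positivity))
              (pow_nonneg (by linarith) _)) P hP0 hP1
  refine ⟨C, hC.le, fun M hM n hn hnM ↦ ?_⟩
  have hℓ1 : 1 ≤ Real.log M := one_le_log_of_three_le hM
  have hℓ0 : Real.log M ≠ 0 := by linarith
  have hℓpos : 0 < Real.log M := by linarith
  have hD := divWeight_nonneg n
  have hκ := kappa_nonneg' n
  obtain ⟨hY0, -⟩ := log_div_nonneg_and_le hM hn hnM
  have h' := h M hM n hn hnM
  set ℓ := Real.log M with hℓ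
  set Y := Real.log (M / n) with hY
  -- identify the main term: `Σ_c P_c(−2c)Y^{c−1}/ℓ^c = (−2P′)(Y/ℓ)/ℓ`
  have hderiv : (derivative P).eval (Y / ℓ) =
      ∑ c ∈ Finset.range (P.natDegree + 1), P.coeff c * (c : ℝ) * (Y / ℓ) ^ (c - 1) := by
    rw [Polynomial.derivative_eval]
    exact Polynomial.sum_over_range _ (fun j ↦ by simp)
  have hterm : ∀ c ∈ Finset.range (P.natDegree + 1),
      mainConst n * (P.coeff c * (-(2 * (c : ℝ)) * Y ^ (c - 1) / ℓ ^ c)) =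
        -(2 : ℝ) * (mainConst n * (P.coeff c * (c : ℝ) * (Y / ℓ) ^ (c - 1)) / ℓ) := by
    intro c _
    rcases Nat.eq_zero_or_pos c with rfl | hcpos
    · rw [hP0]; simp
    · have hℓc : ℓ ^ c = ℓ ^ (c - 1) * ℓ := by
        rw [← pow_succ, Nat.sub_add_cancel hcpos]
      rw [div_pow, hℓc]
      field_simp
  have hmain : mainConst n * ∑ c ∈ Finset.range (P.natDegree + 1), P.coeff c *
      (-(2 * (c : ℝ)) * Y ^ (c - 1) / ℓ ^ c) =
      mainConst n * (-(2 : ℝ) • derivative P).eval (Y / ℓ) / ℓ ^ 1 := by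
    rw [Finset.mul_sum, Finset.sum_congr rfl hterm, Polynomial.eval_smul, smul_eq_mul, hderiv, pow_one]
    simp only [Finset.mul_sum, Finset.sum_div]
    exact Finset.sum_congr rfl fun c _ ↦ by ring
  rw [hmain] at h'
  refine h'.trans ?_
  have h2 : 0 ≤ C * divWeight n * (1 / ((1 + Y) ^ 2 * ℓ ^ 1)) := by positivity
  calc C * divWeight n * (1 + kappa n) / ℓ ^ (1 + 1)
      = C * divWeight n * ((1 + kappa n) / ℓ ^ (1 + 1)) := by ring
    _ ≤ C * divWeight n * ((1 + kappa n) / ℓ ^ (1 + 1)) + C * divWeight n * (1 / ((1 + Y) ^ 2 * ℓ ^ 1)) :=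
        le_add_of_nonneg_right h2
    _ = _ := by ring

/-- **Master input `t = (log k)²·τ(k)`**: `R = 2P`, `s = 0` (`P₀ = P₁ = 0`; two-scale format, second scale unused).
[cite: KowalskiMichelVanderKam2000, (23)–(28) and Prop. 5.1 — derivation] -/
theorem masterInput_tau_logSq (P : ℝ[X]) (hP0 : P.coeff 0 = 0) (hP1 : P.coeff 1 = 0) :
    ∃ C : ℝ, 0 ≤ C ∧ ∀ M : ℝ, 3 ≤ M → ∀ n : ℕ, n ≠ 0 → (n : ℝ) ≤ M →
      |∑ c ∈ Finset.range (P.natDegree + 1), P.coeff c *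
          ((∑ k ∈ Icc 1 ⌊M / n⌋₊, (if k.Coprime n then W k else 0) * ((k.divisors.card : ℝ) * Real.log k ^ 2) *
            Real.log (M / n / k) ^ c) / Real.log M ^ c) -
        mainConst n * ((2 : ℝ) • P).eval (Real.log (M / n) / Real.log M) / Real.log M ^ 0| ≤
        C * divWeight n * ((1 + kappa n) / Real.log M ^ (0 + 1) +
          1 / ((1 + Real.log (M / n)) ^ 2 * Real.log M ^ 0)) := by
  obtain ⟨C, hC, h⟩ := abs_profileLayer_sub_le
    (fun n y c ↦ ∑ k ∈ Icc 1 ⌊y⌋₊, (if k.Coprime n then W k else 0) * ((k.divisors.card : ℝ) * Real.log k ^ 2) *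
      Real.log (y / k) ^ c)
    (fun _ ↦ (2 : ℝ)) (zero_le_one : 0 ≤ 1) (fun c hc ↦ by
      obtain ⟨K, hK, hK'⟩ := abs_coprimeSumPow_logSq_sub_le hc
      refine ⟨K, hK, fun n hn y hy ↦ ?_⟩
      have hκ := kappa_nonneg' n
      have hD := divWeight_nonneg n
      have hre : ∑ k ∈ Icc 1 ⌊y⌋₊, (if k.Coprime n then W k else 0) * ((k.divisors.card : ℝ) * Real.log k ^ 2) *
          Real.log (y / k) ^ c = ∑ k ∈ Icc 1 ⌊y⌋₊, copTauW n k * Real.log k ^ 2 * Real.log (y / k) ^ c :=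
        Finset.sum_congr rfl fun k _ ↦ by rw [← copW_mul_card_eq]; ring
      rw [hre, Nat.sub_zero]
      have hly : 0 ≤ Real.log y := Real.log_nonneg hy
      calc _ ≤ K * divWeight n * (1 + Real.log y) ^ (c - 1) := hK' n hn y hy
        _ = K * divWeight n * 1 * (1 + Real.log y) ^ (c - 1) := by rw [mul_one]
        _ ≤ K * divWeight n * (1 + kappa n) * (1 + Real.log y) ^ (c - 1) :=
            mul_le_mul_of_nonneg_right (mul_le_mul_of_nonneg_left (by linarith) (by positivity))
              (pow_nonneg (by linarith) _)) P hP0 hP1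
  refine ⟨C, hC.le, fun M hM n hn hnM ↦ ?_⟩
  have hℓ1 : 1 ≤ Real.log M := one_le_log_of_three_le hM
  have hℓpos : 0 < Real.log M := by linarith
  have hD := divWeight_nonneg n
  have hκ := kappa_nonneg' n
  obtain ⟨hY0, -⟩ := log_div_nonneg_and_le hM hn hnM
  have h' := h M hM n hn hnM
  have hmain : mainConst n * ∑ c ∈ Finset.range (P.natDegree + 1), P.coeff c *
      (2 * Real.log (M / n) ^ (c - 0) / Real.log M ^ c) =
      mainConst n * ((2 : ℝ) • P).eval (Real.log (M / n) / Real.log M) / Real.log M ^ 0 := by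
    rw [pow_zero, div_one, Polynomial.eval_smul, smul_eq_mul, Polynomial.eval_eq_sum_range]
    simp only [Finset.mul_sum, Nat.sub_zero, div_pow]
    exact Finset.sum_congr rfl fun c _ ↦ by ring
  rw [hmain] at h'
  refine h'.trans ?_
  have h2 : 0 ≤ C * divWeight n * (1 / ((1 + Real.log (M / n)) ^ 2 * Real.log M ^ 0)) := by positivity
  calc C * divWeight n * (1 + kappa n) / Real.log M ^ (0 + 1)
      = C * divWeight n * ((1 + kappa n) / Real.log M ^ (0 + 1)) := by ring
    _ ≤ C * divWeight n * ((1 + kappa n) / Real.log M ^ (0 + 1)) +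
        C * divWeight n * (1 / ((1 + Real.log (M / n)) ^ 2 * Real.log M ^ 0)) := le_add_of_nonneg_right h2
    _ = _ := by ring
/-! ### `(log k)^σ·τ(k)`, `σ ≥ 3`: no main term -/

/-- **`σ ≥ 3`: the `(log k)^σ·τ`-decorated profile coordinate is `O(D(n)(1+κ(n))·log^{σ−2}M/log M)`** (`P₀ = P₁ = 0`,
`M ≥ 3`, `1 ≤ n ≤ M`; the formal main exponent is `σ − 2` but `κ_{σ,c} = 0`). Crude-size input with `A(M) = log^{σ−2}M/log M`.
[cite: KowalskiMichelVanderKam2000, (23)–(28) — derivation] -/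
theorem abs_decorProfile_tau_logPow_le {σ : ℕ} (hσ : 3 ≤ σ) (P : ℝ[X]) (hP0 : P.coeff 0 = 0) (hP1 : P.coeff 1 = 0) :
    ∃ C : ℝ, 0 < C ∧ ∀ M : ℝ, 3 ≤ M → ∀ n : ℕ, n ≠ 0 → (n : ℝ) ≤ M →
      |∑ c ∈ Finset.range (P.natDegree + 1), P.coeff c *
          ((∑ k ∈ Icc 1 ⌊M / n⌋₊, (if k.Coprime n then W k else 0) * ((k.divisors.card : ℝ) * Real.log k ^ σ) *
            Real.log (M / n / k) ^ c) / Real.log M ^ c)| ≤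
        C * divWeight n * (1 + kappa n) * Real.log M ^ (σ - 2) / Real.log M := by
  obtain ⟨C, hC, h⟩ := abs_profileLayer_shift_sub_le
    (fun n y c ↦ ∑ k ∈ Icc 1 ⌊y⌋₊, (if k.Coprime n then W k else 0) * ((k.divisors.card : ℝ) * Real.log k ^ σ) *
      Real.log (y / k) ^ c)
    (fun _ ↦ (0 : ℝ)) (σ - 2) (zero_le_one : 0 ≤ 1)
    (fun c hc ↦ by
      obtain ⟨K, hK, hK'⟩ := abs_coprimeSumPow_logPow_sub_le σ hc
      refine ⟨K, hK, fun n hn y hy ↦ ?_⟩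
      have hκ := kappa_nonneg' n
      have hD := divWeight_nonneg n
      have hly : 0 ≤ Real.log y := Real.log_nonneg hy
      have hre : ∑ k ∈ Icc 1 ⌊y⌋₊, (if k.Coprime n then W k else 0) * ((k.divisors.card : ℝ) * Real.log k ^ σ) *
          Real.log (y / k) ^ c = ∑ k ∈ Icc 1 ⌊y⌋₊, copTauW n k * Real.log k ^ σ * Real.log (y / k) ^ c :=
        Finset.sum_congr rfl fun k _ ↦ by rw [← copW_mul_card_eq]; ring
      have h0 := hK' n hn y hy
      rw [kappaCoeff_eq_zero_of_three_le hσ c, zero_mul, zero_mul] at h0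
      rw [hre, zero_mul, zero_mul, show σ - 2 + c - 0 = σ + c - 2 by omega]
      calc _ ≤ K * divWeight n * (1 + Real.log y) ^ (σ + c - 2) / (1 + Real.log y) := h0
        _ = K * divWeight n * 1 * (1 + Real.log y) ^ (σ + c - 2) / (1 + Real.log y) := by rw [mul_one]
        _ ≤ K * divWeight n * (1 + kappa n) * (1 + Real.log y) ^ (σ + c - 2) / (1 + Real.log y) := by
            gcongr; linarith) P hP0 hP1
  refine ⟨C, hC, fun M hM n hn hnM ↦ ?_⟩
  have h' := h M hM n hn hnM
  simp only [zero_mul, zero_div, mul_zero, Finset.sum_const_zero, sub_zero, zero_add, pow_one] at h'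
  exact h'
/-! ### `P₂(k)·τ(k)`: master format, and the `(log k)^σ` shifts -/

/-- The `P₂τ`-engine of `…DiagDecorPrimeSq` in one format for every `c ≥ 2`:
`|Σ_{k≤y} a_n(k)P₂(k)logᶜ(y/k) + 2E_n logᶜy| ≤ C·D(n)(1+κ(n))(1+log y)^{c−1}`. [cite: KowalskiMichelVanderKam2000, (23)–(28) — derivation] -/
theorem abs_copTauW_primeSq_sum_add_le {c : ℕ} (hc : 2 ≤ c) :
    ∃ C : ℝ, 0 < C ∧ ∀ n : ℕ, n ≠ 0 → ∀ y : ℝ, 1 ≤ y →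
      |∑ k ∈ Icc 1 ⌊y⌋₊, copTauW n k * (∑ p ∈ k.primeFactors, Real.log p ^ 2) * Real.log (y / k) ^ c +
          2 * mainConst n * Real.log y ^ c| ≤ C * divWeight n * (1 + kappa n) * (1 + Real.log y) ^ (c - 1) := by
  have h2ex : ∃ C₂ : ℝ, 0 < C₂ ∧ ∀ n : ℕ, n ≠ 0 → ∀ y : ℝ, 1 ≤ y →
      |∑ k ∈ Icc 1 ⌊y⌋₊, copTauW n k * Real.log (y / k) ^ c * ∑ p ∈ k.primeFactors, Real.log p ^ 2 +
          2 * mainConst n * Real.log y ^ c| ≤ C₂ * divWeight n * (1 + kappa n) * (1 + Real.log y) ^ (c - 1) := by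
    rcases Nat.lt_or_ge c 3 with h3 | h3
    · have hc2 : c = 2 := by omega
      subst hc2
      simpa using abs_coprimeSum_primeSq_add_le
    · exact abs_coprimeSumPow_primeSq_add_le h3
  obtain ⟨C₂, hC₂, h2⟩ := h2ex
  refine ⟨C₂, hC₂, fun n hn y hy ↦ ?_⟩
  have hre : ∑ k ∈ Icc 1 ⌊y⌋₊, copTauW n k * (∑ p ∈ k.primeFactors, Real.log p ^ 2) * Real.log (y / k) ^ c =
      ∑ k ∈ Icc 1 ⌊y⌋₊, copTauW n k * Real.log (y / k) ^ c * ∑ p ∈ k.primeFactors, Real.log p ^ 2 :=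
    Finset.sum_congr rfl fun k _ ↦ by ring
  rw [hre]
  exact h2 n hn y hy

/-- **Master input `t = P₂(k)·τ(k)`**: `R = −2P`, `s = 0` (`P₀ = P₁ = 0`; two-scale format, second scale unused).
[cite: KowalskiMichelVanderKam2000, (23)–(28) and Prop. 5.1 — derivation] -/
theorem masterInput_tau_primeSq (P : ℝ[X]) (hP0 : P.coeff 0 = 0) (hP1 : P.coeff 1 = 0) :
    ∃ C : ℝ, 0 ≤ C ∧ ∀ M : ℝ, 3 ≤ M → ∀ n : ℕ, n ≠ 0 → (n : ℝ) ≤ M →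
      |∑ c ∈ Finset.range (P.natDegree + 1), P.coeff c *
          ((∑ k ∈ Icc 1 ⌊M / n⌋₊, (if k.Coprime n then W k else 0) *
              ((k.divisors.card : ℝ) * ∑ p ∈ k.primeFactors, Real.log p ^ 2) *
            Real.log (M / n / k) ^ c) / Real.log M ^ c) -
        mainConst n * (-(2 : ℝ) • P).eval (Real.log (M / n) / Real.log M) / Real.log M ^ 0| ≤
        C * divWeight n * ((1 + kappa n) / Real.log M ^ (0 + 1) +
          1 / ((1 + Real.log (M / n)) ^ 2 * Real.log M ^ 0)) := by
  obtain ⟨C, hC, h⟩ := abs_profileLayer_sub_le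
    (fun n y c ↦ ∑ k ∈ Icc 1 ⌊y⌋₊, (if k.Coprime n then W k else 0) *
      ((k.divisors.card : ℝ) * ∑ p ∈ k.primeFactors, Real.log p ^ 2) * Real.log (y / k) ^ c)
    (fun _ ↦ (-2 : ℝ)) (zero_le_one : 0 ≤ 1) (fun c hc ↦ by
      obtain ⟨K, hK, hK'⟩ := abs_copTauW_primeSq_sum_add_le hc
      refine ⟨K, hK, fun n hn y hy ↦ ?_⟩
      have hre : ∑ k ∈ Icc 1 ⌊y⌋₊, (if k.Coprime n then W k else 0) *
          ((k.divisors.card : ℝ) * ∑ p ∈ k.primeFactors, Real.log p ^ 2) * Real.log (y / k) ^ c =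
          ∑ k ∈ Icc 1 ⌊y⌋₊, copTauW n k * (∑ p ∈ k.primeFactors, Real.log p ^ 2) * Real.log (y / k) ^ c :=
        Finset.sum_congr rfl fun k _ ↦ by rw [← copW_mul_card_eq]; ring
      rw [hre, Nat.sub_zero, show ∑ k ∈ Icc 1 ⌊y⌋₊, copTauW n k * (∑ p ∈ k.primeFactors, Real.log p ^ 2) *
          Real.log (y / k) ^ c - -2 * mainConst n * Real.log y ^ c =
          ∑ k ∈ Icc 1 ⌊y⌋₊, copTauW n k * (∑ p ∈ k.primeFactors, Real.log p ^ 2) * Real.log (y / k) ^ c +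
            2 * mainConst n * Real.log y ^ c by ring]
      exact hK' n hn y hy) P hP0 hP1
  refine ⟨C, hC.le, fun M hM n hn hnM ↦ ?_⟩
  have hℓ1 : 1 ≤ Real.log M := one_le_log_of_three_le hM
  have hℓpos : 0 < Real.log M := by linarith
  have hD := divWeight_nonneg n
  have hκ := kappa_nonneg' n
  obtain ⟨hY0, -⟩ := log_div_nonneg_and_le hM hn hnM
  have h' := h M hM n hn hnM
  have hmain : mainConst n * ∑ c ∈ Finset.range (P.natDegree + 1), P.coeff c *
      (-2 * Real.log (M / n) ^ (c - 0) / Real.log M ^ c) =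
      mainConst n * (-(2 : ℝ) • P).eval (Real.log (M / n) / Real.log M) / Real.log M ^ 0 := by
    rw [pow_zero, div_one, Polynomial.eval_smul, smul_eq_mul, Polynomial.eval_eq_sum_range]
    simp only [Finset.mul_sum, Nat.sub_zero, div_pow]
    exact Finset.sum_congr rfl fun c _ ↦ by ring
  rw [hmain] at h'
  refine h'.trans ?_
  have h2 : 0 ≤ C * divWeight n * (1 / ((1 + Real.log (M / n)) ^ 2 * Real.log M ^ 0)) := by positivity
  calc C * divWeight n * (1 + kappa n) / Real.log M ^ (0 + 1)
      = C * divWeight n * ((1 + kappa n) / Real.log M ^ (0 + 1)) := by ring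
    _ ≤ C * divWeight n * ((1 + kappa n) / Real.log M ^ (0 + 1)) +
        C * divWeight n * (1 / ((1 + Real.log (M / n)) ^ 2 * Real.log M ^ 0)) := le_add_of_nonneg_right h2
    _ = _ := by ring

/-- **`σ ≥ 1`: the `(log k)^σ·P₂(k)τ(k)`-decorated coprime Selberg sum has no main term**:
`|Σ_{k≤y} a_n(k)P₂(k)(log k)^σ logᶜ(y/k)| ≤ C·D(n)(1+κ(n))(1+log y)^{σ+c}/(1+log y)` (`c ≥ 2`).
[cite: KowalskiMichelVanderKam2000, (23)–(28) — derivation] -/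
theorem abs_copTauW_primeSq_logPow_sum_le {σ : ℕ} (hσ : 1 ≤ σ) {c : ℕ} (hc : 2 ≤ c) :
    ∃ C : ℝ, 0 < C ∧ ∀ n : ℕ, n ≠ 0 → ∀ y : ℝ, 1 ≤ y →
      |∑ k ∈ Icc 1 ⌊y⌋₊, copTauW n k * (∑ p ∈ k.primeFactors, Real.log p ^ 2) * Real.log k ^ σ *
          Real.log (y / k) ^ c| ≤
        C * divWeight n * (1 + kappa n) * (1 + Real.log y) ^ (σ + c) / (1 + Real.log y) := by
  obtain ⟨C, hC, h⟩ := abs_kSum_logPow_shift_sub_le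
    (fun n k ↦ copTauW n k * (∑ p ∈ k.primeFactors, Real.log p ^ 2))
    (fun _ ↦ (-2 : ℝ)) (zero_le_one : 0 ≤ 1)
    (fun c' hc' ↦ by
      obtain ⟨K, hK, hK'⟩ := abs_copTauW_primeSq_sum_add_le hc'
      refine ⟨K, hK, fun n hn y hy ↦ ?_⟩
      have h0 := hK' n hn y hy
      rw [Nat.sub_zero, show ∑ k ∈ Icc 1 ⌊y⌋₊,
          copTauW n k * (∑ p ∈ k.primeFactors, Real.log p ^ 2) * Real.log (y / k) ^ c' -
          -2 * mainConst n * Real.log y ^ c' = ∑ k ∈ Icc 1 ⌊y⌋₊,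
          copTauW n k * (∑ p ∈ k.primeFactors, Real.log p ^ 2) * Real.log (y / k) ^ c' +
          2 * mainConst n * Real.log y ^ c' by ring]
      exact h0) σ hc
  refine ⟨C, hC, fun n hn y hy ↦ ?_⟩
  have h' := h n hn y hy
  have hcoef : (∑ β ∈ Finset.range (σ + 1), (σ.choose β : ℝ) * (-1) ^ β * (-2 : ℝ)) = 0 := by
    have h1 := sum_choose_mul_neg_one_pow_mul_one_eq_zero hσ
    rw [← Finset.sum_mul] at h1 ⊢
    rw [mul_one] at h1
    rw [h1, zero_mul]
  rw [hcoef, zero_mul, zero_mul, sub_zero, Nat.sub_zero] at h'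
  exact h'

/-- **`σ ≥ 1`: the `(log k)^σ·P₂(k)τ(k)`-decorated profile coordinate is `O(D(n)(1+κ(n))·log^σM/log M)`**
(`P₀ = P₁ = 0`, `M ≥ 3`, `1 ≤ n ≤ M`). Crude-size input with `A(M) = log^σM/log M`.
[cite: KowalskiMichelVanderKam2000, (23)–(28) — derivation] -/
theorem abs_decorProfile_tau_primeSq_logPow_le {σ : ℕ} (hσ : 1 ≤ σ) (P : ℝ[X]) (hP0 : P.coeff 0 = 0)
    (hP1 : P.coeff 1 = 0) :
    ∃ C : ℝ, 0 < C ∧ ∀ M : ℝ, 3 ≤ M → ∀ n : ℕ, n ≠ 0 → (n : ℝ) ≤ M →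
      |∑ c ∈ Finset.range (P.natDegree + 1), P.coeff c *
          ((∑ k ∈ Icc 1 ⌊M / n⌋₊, (if k.Coprime n then W k else 0) *
              ((k.divisors.card : ℝ) * (∑ p ∈ k.primeFactors, Real.log p ^ 2) * Real.log k ^ σ) *
              Real.log (M / n / k) ^ c) / Real.log M ^ c)| ≤
        C * divWeight n * (1 + kappa n) * Real.log M ^ σ / Real.log M := by
  obtain ⟨C, hC, h⟩ := abs_profileLayer_shift_sub_le
    (fun n y c ↦ ∑ k ∈ Icc 1 ⌊y⌋₊, (if k.Coprime n then W k else 0) *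
      ((k.divisors.card : ℝ) * (∑ p ∈ k.primeFactors, Real.log p ^ 2) * Real.log k ^ σ) * Real.log (y / k) ^ c)
    (fun _ ↦ (0 : ℝ)) σ (zero_le_one : 0 ≤ 1)
    (fun c hc ↦ by
      obtain ⟨K, hK, hK'⟩ := abs_copTauW_primeSq_logPow_sum_le hσ hc
      refine ⟨K, hK, fun n hn y hy ↦ ?_⟩
      have hre : ∑ k ∈ Icc 1 ⌊y⌋₊, (if k.Coprime n then W k else 0) *
          ((k.divisors.card : ℝ) * (∑ p ∈ k.primeFactors, Real.log p ^ 2) * Real.log k ^ σ) * Real.log (y / k) ^ c =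
          ∑ k ∈ Icc 1 ⌊y⌋₊, copTauW n k * (∑ p ∈ k.primeFactors, Real.log p ^ 2) * Real.log k ^ σ *
            Real.log (y / k) ^ c :=
        Finset.sum_congr rfl fun k _ ↦ by rw [← copW_mul_card_eq]; ring
      rw [hre]
      simpa using hK' n hn y hy) P hP0 hP1
  refine ⟨C, hC, fun M hM n hn hnM ↦ ?_⟩
  have h' := h M hM n hn hnM
  simp only [zero_mul, zero_div, mul_zero, Finset.sum_const_zero, sub_zero, zero_add, pow_one] at h'
  exact h'

end Summit.Parity.GeneralizedHardyLittlewood.Theorems.MomentsBeyondDiagonal.DiagKernel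

end
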